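import Mathlib
import Summits.KontsevichZagierPeriods.Zeta5Search.ZeroWindowClasses
import Summits.KontsevichZagierPeriods.Zeta5Search.Ray4OriginWindowO8
import Summits.KontsevichZagierPeriods.Zeta5Search.ClassDataDecide
import HarnessLib

/-!
# ζ(5) search — T1-MAP RAY KIT: general (non-AP) rays `b(n) = n·β`, the two type-space window reductions, decidable mirrors, and the universal `M = 8` data (HONEST FRAMING: systematic search; no irrationality claim unless certified)

Cell `pub-zeta5`, GEN-2 seat generation 16.  The census T1 map (g22, `xsave/g22/t1map/t1map.md`) lists 17 directions
`β = (β₀; β₁, …, β₇)` of the Brown–Zudilin cellular family whose rays `b(n) = n·β` carry the denominator savings of the search;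
two of them — g8 #5 `β = (51; 21,19,18,16,15,13,12)` (`d = 39`) and g8 #1 `β = (85; 35,32,30,27,25,22,20)` (`d = 64`) — are NOT
arithmetic progressions, so `CellKitRays.bLin` does not cover them.  This kit supplies, once for every such ray:

* `bRay β n` — the ray `i ↦ n·β_i` of an integer direction list `β` (`bRec n = bRay [41,17,16,15,14,13,12,11] n` definitionally);
* `zeroWindow_of_classes` / `originWindow_of_classes` — the two type-space window reductions (`ZeroWindows.bound_of_classes`, law
  `TypeSpaceLawZero`, bound `6 − 2M`; `OriginWindows.bound_of_classes`, law `TypeSpaceLawOrigin`, bound `5 − 2M`) for an ARBITRARY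
  parameter function `b` given its four ray facts (polytope, `e₇`-shift, `b₀`, `d = dOf b`) as hypotheses, so that a ray file only
  proves those four facts;
* `ZeroWindowClassesD` / `OriginWindowClassesD` — the two class-structure predicates restated over the computable mirrors of
  `ClassDataDecide` (`classExpD`, `classPoleCountD`, `classTypeListD`), the `iff`s, and `Decidable` instances for
  `ZeroWindows.ZeroWindowClasses` / `OriginWindows.OriginWindowClasses` (so window instances are kernel facts by `decide`);
* the UNIVERSAL `M = 8` type data: on every T1-map ray examined (record, #4, #5, #1) the top zero window has deep palindrome
  `[1,-5,-5,1]` (`ZeroWindows.D8`) with extra pair `Sz8 = [[1,-6,-3,1]]`, and the top origin window has the ray-#4 lists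
  `Ray4Windows.D8 / S8` on the line `u8 = (33, −49)`, `c8 = −174`, plus — on rays with odd `β₀` — the odd-centre type `Pc8 = [[1,-5,-5,1]]`;
  the one new rational identity `pc8_pt` is PROVED (`decide +kernel`) and `lineData8c : LineData u8 c8 D8 S8 Pc8` assembled from the landed
  `Ray4Windows.d8_* / s8_*`.

`p`-adic bookkeeping of rational numbers along residue classes; nothing here bears on irrationality.
-/

noncomputable section

open Finset

namespace Summit.KontsevichZagierPeriods.Zeta5Search.T1Rays

open Summit.KontsevichZagierPeriods.Zeta5Search.CasoratianValuation (InPolytope shift casoratian)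
open Summit.KontsevichZagierPeriods.Zeta5Search.ClusterValuation
open Summit.KontsevichZagierPeriods.Zeta5Search.SecondOrder
open Summit.KontsevichZagierPeriods.Zeta5Search.ResidueLaw
open Summit.KontsevichZagierPeriods.Zeta5Search.WedgeDictionary (dOf)
open Summit.KontsevichZagierPeriods.Zeta5Search.LevelClass (typeW typeV)
open Summit.KontsevichZagierPeriods.Zeta5Search.ZeroWindows (deepPoint pairPoint ZeroWindowClasses)
open Summit.KontsevichZagierPeriods.Zeta5Search.OriginWindows (lineVal deepPt dirVec OriginWindowClasses LineData)
open Summit.KontsevichZagierPeriods.Zeta5Search.ClassDecide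
open Summit.KontsevichZagierPeriods.Zeta5Search.TypeEval (typeRho_eq_typeRhoC)

/-! ## §1 Rays `b(n) = n·β` -/

/-- **The ray of an integer direction** `β = [β₀, β₁, …, β₇]`: `b(n)_i = n·β_i` (entries beyond the list are `0`). -/
def bRay (β : List ℤ) (n : ℕ) : ℕ → ℤ := fun i => (n : ℤ) * β.getD i 0

/-- The record ray is `bRay [41, 17, 16, 15, 14, 13, 12, 11]` (definitionally). -/
theorem bRec_eq_bRay (n : ℕ) : bRec n = bRay [41, 17, 16, 15, 14, 13, 12, 11] n := rfl

/-! ## §2 The two window reductions for an arbitrary parameter function -/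

variable {p : ℕ}

/-- **ZERO-regime window reduction** (`TypeSpaceLawZero`, a theorem): given the polytope facts of `b` and of its `e₇`-shift, `b₀ = B`,
`dOf b = d`, a prime `5 ≤ p ≤ B` with `B + 2 < p²`, `M ≥ 6` even, DEG `p(M − 2) ≤ 2d + 1`, deep palindromes `D` and extra pairs `S` with
`|D| + |S| ≤ 2`, the class structure gives `v_p(Cas₇(b)) ≥ 6 − 2M`. -/
theorem zeroWindow_of_classes (b : ℕ → ℤ) (B : ℕ) (d : ℤ) (p M : ℕ) (D S : List (List ℤ))
    (hb : InPolytope b) (hb7 : InPolytope (shift b 7)) (hB : b 0 = (B : ℤ)) (hd : dOf b = d)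
    (hp : p.Prime) (h5 : 5 ≤ p) (hpn : p ≤ B) (hp2 : B + 2 < p ^ 2) (hM : 6 ≤ M) (hMe : Even M)
    (hdeg : (p : ℤ) * ((M : ℤ) - 2) ≤ 2 * d + 1)
    (hD : ∀ T ∈ D, T.reverse = T) (hlen : D.length + S.length ≤ 2) (hC : ZeroWindowClasses b p M D S)
    (hne : casoratian b 7 ≠ 0) : (6 : ℤ) - 2 * M ≤ padicValRat p (casoratian b 7) := by
  haveI : Fact p.Prime := ⟨hp⟩
  have hpb : (p : ℤ) ≤ b 0 := by rw [hB]; exact_mod_cast hpn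
  have hp2' : (b 0 + 2 : ℤ) < (p : ℤ) ^ 2 := by rw [hB]; exact_mod_cast hp2
  have hdeg' : (p : ℤ) * ((M : ℤ) - 2) + ∑ x ∈ range p, classExp b p x ≤ -4 := by
    rw [sum_classExp_range b hb h5, hd]; omega
  exact ZeroWindows.bound_of_classes b 7 M D S hb hb7 (by norm_num) (by norm_num) h5 hpb hp2' hM hMe hdeg' hD hlen hC hne

/-- **ORIGIN-regime window reduction** (`TypeSpaceLawOrigin`, a theorem): the same ray facts, a primitive direction `u ≢ 0 (mod p)` with line
data `LineData u c D S P`, and the class structure `OriginWindowClasses b p M D S P` give `v_p(Cas₇(b)) ≥ 5 − 2M`. -/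
theorem originWindow_of_classes (b : ℕ → ℤ) (B : ℕ) (d : ℤ) (p M : ℕ) (D S P : List (List ℤ)) (u : ℤ × ℤ) (c : ℚ)
    (hb : InPolytope b) (hb7 : InPolytope (shift b 7)) (hB : b 0 = (B : ℤ)) (hd : dOf b = d)
    (hp : p.Prime) (h5 : 5 ≤ p) (hpn : p ≤ B) (hp2 : B + 2 < p ^ 2) (hM : 6 ≤ M) (hMe : Even M)
    (hdeg : (p : ℤ) * ((M : ℤ) - 2) ≤ 2 * d + 1)
    (hu : ¬ ((p : ℤ) ∣ u.1 ∧ (p : ℤ) ∣ u.2)) (hI : LineData u c D S P) (hC : OriginWindowClasses b p M D S P)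
    (hne : casoratian b 7 ≠ 0) : (5 : ℤ) - 2 * M ≤ padicValRat p (casoratian b 7) := by
  haveI : Fact p.Prime := ⟨hp⟩
  have hpb : (p : ℤ) ≤ b 0 := by rw [hB]; exact_mod_cast hpn
  have hp2' : (b 0 + 2 : ℤ) < (p : ℤ) ^ 2 := by rw [hB]; exact_mod_cast hp2
  have hdeg' : (p : ℤ) * ((M : ℤ) - 2) + ∑ x ∈ range p, classExp b p x ≤ -4 := by
    rw [sum_classExp_range b hb h5, hd]; omega
  exact OriginWindows.bound_of_classes b 7 M D S P u c hb hb7 (by norm_num) (by norm_num) h5 hpb hp2' hM hMe hu hdeg' hC hI hne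

/-! ## §3 Decidable mirrors of the two class-structure predicates -/

/-- `ZeroWindowClasses` restated over the computable mirrors of `ClassDataDecide`. -/
def ZeroWindowClassesD (b : ℕ → ℤ) (p M : ℕ) (D S : List (List ℤ)) : Prop :=
  (∀ x, x < p → 1 ≤ classPoleCountD b p x → -(M : ℤ) ≤ classExpD b p x) ∧
  (∀ x, x < p → 1 ≤ classPoleCountD b p x → classExpD b p x = -(M : ℤ) → ¬ CentreIn b p x ∧ classTypeListD b p x ∈ D) ∧
  (∀ y, y < p → 1 ≤ classPoleCountD b p y → classExpD b p y = -(M : ℤ) + 1 →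
      (∃ T ∈ D, isRaise T (classTypeListD b p y) = true ∨ (¬ (2 : ℤ) ∣ b 0 ∧ CentreIn b p y ∧ classTypeListD b p y = T)) ∨
      (¬ CentreIn b p y ∧ ∃ s ∈ S, classTypeListD b p y = s ∨ classTypeListD b p (conjClass b p y) = s))

/-- `ZeroWindowClassesD ↔ ZeroWindowClasses`. -/
theorem zeroWindowClassesD_iff (b : ℕ → ℤ) (p M : ℕ) (D S : List (List ℤ)) :
    ZeroWindowClassesD b p M D S ↔ ZeroWindowClasses b p M D S := by
  unfold ZeroWindowClassesD ZeroWindows.ZeroWindowClasses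
  rw [classExpD_eq, classPoleCountD_eq, classTypeListD_eq]

/-- `OriginWindowClasses` restated over the computable mirrors of `ClassDataDecide`. -/
def OriginWindowClassesD (b : ℕ → ℤ) (p M : ℕ) (D S P : List (List ℤ)) : Prop :=
  (∀ x, x < p → 1 ≤ classPoleCountD b p x → -(M : ℤ) ≤ classExpD b p x) ∧
  (∀ x, x < p → 1 ≤ classPoleCountD b p x → classExpD b p x = -(M : ℤ) → ¬ CentreIn b p x ∧ classTypeListD b p x ∈ D) ∧
  (∀ y, y < p → 1 ≤ classPoleCountD b p y → classExpD b p y = -(M : ℤ) + 1 →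
      (¬ CentreIn b p y ∧ classTypeListD b p y ∈ S) ∨ (¬ (2 : ℤ) ∣ b 0 ∧ CentreIn b p y ∧ classTypeListD b p y ∈ P))

/-- `OriginWindowClassesD ↔ OriginWindowClasses`. -/
theorem originWindowClassesD_iff (b : ℕ → ℤ) (p M : ℕ) (D S P : List (List ℤ)) :
    OriginWindowClassesD b p M D S P ↔ OriginWindowClasses b p M D S P := by
  unfold OriginWindowClassesD OriginWindows.OriginWindowClasses
  rw [classExpD_eq, classPoleCountD_eq, classTypeListD_eq]

set_option synthInstance.maxSize 4096 in
set_option synthInstance.maxHeartbeats 400000 in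
/-- The zero mirror is decidable by evaluation. -/
instance decZeroWindowClassesD (b : ℕ → ℤ) (p M : ℕ) (D S : List (List ℤ)) : Decidable (ZeroWindowClassesD b p M D S) := by
  unfold ZeroWindowClassesD
  refine @instDecidableAnd _ _ ?_ (@instDecidableAnd _ _ ?_ ?_) <;> infer_instance

set_option synthInstance.maxSize 4096 in
set_option synthInstance.maxHeartbeats 400000 in
/-- The origin mirror is decidable by evaluation. -/
instance decOriginWindowClassesD (b : ℕ → ℤ) (p M : ℕ) (D S P : List (List ℤ)) :
    Decidable (OriginWindowClassesD b p M D S P) := by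
  unfold OriginWindowClassesD
  refine @instDecidableAnd _ _ ?_ (@instDecidableAnd _ _ ?_ ?_) <;> infer_instance

/-- **`ZeroWindowClasses b p M D S` is decidable** (through the mirror). -/
instance decZeroWindowClasses (b : ℕ → ℤ) (p M : ℕ) (D S : List (List ℤ)) : Decidable (ZeroWindowClasses b p M D S) :=
  decidable_of_iff _ (zeroWindowClassesD_iff b p M D S)

/-- **`OriginWindowClasses b p M D S P` is decidable** (through the mirror). -/
instance decOriginWindowClasses (b : ℕ → ℤ) (p M : ℕ) (D S P : List (List ℤ)) :
    Decidable (OriginWindowClasses b p M D S P) :=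
  decidable_of_iff _ (originWindowClassesD_iff b p M D S P)

/-! ## §4 The universal `M = 8` type data of the T1-map rays -/

/-- Top ZERO window, `M = 8`: the extra conjugate pair `[1,-6,-3,1]` (deep palindrome `ZeroWindows.D8 = [[1,-5,-5,1]]`). -/
def Sz8 : List (List ℤ) := [[1, -6, -3, 1]]

/-- Top ORIGIN window, `M = 8`, rays with odd `β₀`: the odd-centre sub-deep type (a palindrome). -/
def Pc8 : List (List ℤ) := [[1, -5, -5, 1]]

set_option maxHeartbeats 8000000 in
/-- Line datum (`M = 8`, origin): the odd-centre type's doubled orbit point `2τ([1,-5,-5,1]) = (−48, 66)` has `Φ_{u8} = c8`. -/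
theorem pc8_pt : lineVal Ray4Windows.u8 (deepPoint [1, -5, -5, 1]) = Ray4Windows.c8 := by
  unfold lineVal ZeroWindows.deepPoint typeTauW typeTauV typeW2 typeV2 LevelClass.typeW LevelClass.typeV
  simp only [typeRho_eq_typeRhoC]
  decide +kernel

/-- **The line data of the universal `M = 8` origin window WITH the odd-centre type HOLD** (`Ray4Windows.lineData8` + `pc8_pt`). -/
theorem lineData8c : LineData Ray4Windows.u8 Ray4Windows.c8 Ray4Windows.D8 Ray4Windows.S8 Pc8 := by
  obtain ⟨hD, hS, -⟩ := Ray4Windows.lineData8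
  refine ⟨hD, hS, ?_⟩
  intro T hT
  simp only [Pc8, List.mem_cons, List.not_mem_nil, or_false] at hT
  rcases hT with rfl
  exact ⟨by decide, pc8_pt⟩

/-- The deep list of the universal zero window is palindromic. -/
theorem d8_pal : ∀ T ∈ ZeroWindows.D8, T.reverse = T := by decide

/-- `|D8| + |Sz8| = 2`. -/
theorem d8_sz8_len : ZeroWindows.D8.length + Sz8.length ≤ 2 := by decide

/-! ## §5 The type inventories of the deeper ZERO windows (`M = 12, 18, 20, 24, 28, 32, 44`)

Read off ray #5 (gen-2 g16 `t1rays/wclass.py`, every window prime with `n ≤ 300` resp. `n ≤ 150`).  The `M = 8` data of §4 and the `M = 12`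
data recur unchanged on ray #1, and the deep palindromes `Dz M` look like functions of `M` alone; the extra conjugate pair need NOT be (ray #1's
`M = 18` window has `Dz18` but a different pair, `Ray1Windows`).  Observations, not claims: every window statement names its lists. -/

/-- `M = 12` (ray #5: `θ ∈ (23/3, 39/5]`): the deep palindrome. -/
def Dz12 : List (List ℤ) := [[1, -1, -6, -6, -1, 1]]
/-- `M = 12`: the extra conjugate pair. -/
def Sz12 : List (List ℤ) := [[1, -2, -6, -5, 0, 1]]
/-- `M = 18` (ray #5: `θ ∈ (24/5, 39/8]`): the deep palindrome. -/
def Dz18 : List (List ℤ) := [[1, 1, -1, -4, -6, -6, -4, -1, 1, 1]]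
/-- `M = 18`: the extra conjugate pair. -/
def Sz18 : List (List ℤ) := [[1, 1, -1, -5, -6, -6, -3, 0, 1, 1]]
/-- `M = 20` (ray #5: `θ ∈ (17/4, 13/3]`): the deep palindrome. -/
def Dz20 : List (List ℤ) := [[1, 1, 0, -3, -6, -6, -6, -3, 0, 1, 1]]
/-- `M = 20`: the extra conjugate pair. -/
def Sz20 : List (List ℤ) := [[1, 1, 0, -3, -5, -6, -6, -3, -1, 1, 1, 1]]
/-- `M = 24` (ray #5: `θ ∈ (7/2, 39/11]`): the deep palindrome. -/
def Dz24 : List (List ℤ) := [[1, 1, 1, -1, -3, -5, -6, -6, -5, -3, -1, 1, 1, 1]]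
/-- `M = 24`: the extra conjugate pair. -/
def Sz24 : List (List ℤ) := [[1, 1, 1, -1, -3, -6, -6, -6, -5, -2, 0, 1, 1, 1]]
/-- `M = 28` (ray #5: `θ ∈ (26/9, 3]`): TWO deep palindromes (even / odd number of class points), no extra pair. -/
def Dz28 : List (List ℤ) :=
  [[1, 1, 1, 1, -1, -3, -5, -6, -6, -6, -5, -3, -1, 1, 1, 1, 1], [1, 1, 1, 1, 0, -2, -4, -6, -6, -6, -6, -4, -2, 0, 1, 1, 1, 1]]
/-- `M = 28`: no extra pair. -/
def Sz28 : List (List ℤ) := []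
/-- `M = 32` (ray #5: `θ ∈ (18/7, 13/5]`): the deep palindrome. -/
def Dz32 : List (List ℤ) := [[1, 1, 1, 1, 1, -1, -3, -5, -6, -6, -6, -6, -5, -3, -1, 1, 1, 1, 1, 1]]
/-- `M = 32`: no extra pair. -/
def Sz32 : List (List ℤ) := []
/-- `M = 44` (ray #5: `θ ∈ (11/6, 13/7]`): the deep palindrome. -/
def Dz44 : List (List ℤ) := [[1, 1, 1, 1, 1, 1, 0, -1, -3, -4, -5, -6, -6, -6, -6, -6, -5, -4, -3, -1, 0, 1, 1, 1, 1, 1, 1]]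
/-- `M = 44`: the extra conjugate pair (occurs from `n = 32` on). -/
def Sz44 : List (List ℤ) := [[1, 1, 1, 1, 1, 1, 0, -1, -2, -3, -5, -6, -6, -6, -6, -6, -5, -4, -3, -2, -1, 1, 1, 1, 1, 1, 1, 1]]

end Summit.KontsevichZagierPeriods.Zeta5Search.T1Rays

end
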